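import Summits.ValiantsHypothesis.ValiantsHypothesis.Theorems.LacunarySymmetroidMatrixDescartesWLawThreeWitnessB
import Summits.ValiantsHypothesis.ValiantsHypothesis.Theorems.LacunarySymmetroidMatrixDescartesStubPsdBlocks

/-!
# `MatrixDescartes` (stmt-ValiantsHypothesis-18050) — BLOCK SUMS OF W-CONFIGURATIONS: attainable positive-root
# counts on a common support are SUPERADDITIVE in the size; hence `w(n) ≥ 10⌊n/3⌋ + (0,2,6)[n mod 3]` for EVERY `n`

HONEST FRAMING.  Cell `pub-symmetroid`, seat `val-sym-mdr-p2` (gen 7); helper file `--supports` the crux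
`Theses.LacunarySymmetroid.MatrixDescartes` (OPEN), NO closure claim.  LOWER-bound / construction bookkeeping for the
typed W-law rows `WLawAt n B` of `…WLawDefs` (W-configuration `X^e J + X^{d₁} P₁ + X^{d₂} P₂ + X^{d₃} Q`, `J` real
symmetric, `P₁, P₂, Q ⪰ 0`, `d₂ < d₁ < e < d₃`; `w(n) := min {B | WLawAt n B}`; kernel: `w(1) = 2`, `w(2) = 6`
(`wLawAt_two_iff_six_le`), `w(3) ≥ 10` (`not_wLawAt_three_nine`, which refutes the candidate `WLaw : w(n) ≤ 3n`)).
This file turns the three small witnesses into an ALL-SIZES statement.  Nothing here bears on `MatrixDescartes` in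
its window (an UPPER bound at fat formats), on `stub_twoSided`, `DoorA26` / `DoorA34`, the census registers, or
`VP ≠ VNP`.

THE LEMMA (`WLawBlockSum.superadditive`).  Fix exponents `(e; d₁, d₂; d₃)`.  If an `a × a` W-configuration on these
exponents has `≥ A` distinct positive determinant roots and a `b × b` one has `≥ B`, then some `(a+b) × (a+b)`
W-configuration ON THE SAME EXPONENTS has `≥ A + B`: take the block-diagonal sum (`Matrix.fromBlocks`, reindexed to
`Fin (a+b)` by `finSumFinEquiv`) of the first with the RESCALED second, letters `c^e J', c^{d₁} P₁', c^{d₂} P₂',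
c^{d₃} Q'` — its determinant at `x` is the second determinant at `c·x` (`eval_det_pencil₄_scale`), so its positive
roots are those of the second divided by `c`; symmetry and positive semidefiniteness are kept (`c > 0`); the block
determinant is the product (`det_pencil₄_blk`, via `Matrix.det_reindex_self` + `Matrix.det_fromBlocks_zero₂₁`); and
`c > 0` is chosen OUTSIDE the finite set of ratios `s / r` of roots (`exists_scale_disjoint`, `Set.Ioi` is infinite),
so the two positive root sets are disjoint and the counts add (`card_posRoots_mul_of_disjoint`).  A witness whose
determinant vanishes identically certifies only `0` and is replaced by the trivial configuration `(0, 0, 0, 1)`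
(`exists_witness_det_ne_zero`).  Exact, elementary; no limits.

WHY A COMMON SUPPORT.  `¬ WLawAt a A ∧ ¬ WLawAt b B ⇒ ¬ WLawAt (a+b) (A+B+1)` does NOT follow in general: the two
refuting configurations may live on different exponent quadruples, and a block sum needs ONE quadruple.  Hence the
companion witness file `…WLawThreeWitnessB` re-found the ten-root `3 × 3` configuration ON THE SUPPORT `(3; 2, 0; 5)`
of the tree's `2 × 2` six-root witness `Fw`; with the scalar `x⁵ − 4x³ + x² + 1` (two roots) all three small sizes
sit on that support: `WAtt[1, 2]`, `WAtt[2, 6]`, `WAtt[3, 10]`.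

CONSEQUENCES (all sizes, support `(3; 2, 0; 5)`; `n = 3j + r`): `WLawBlockSum.watt_all` / `exists_wConfig_many_roots`:
some `n × n` W-configuration has at least `10j + (0, 2, 6)[r]` (`= 10·⌊n/3⌋ + 2·(n%3) + 2·((n%3)/2)`) distinct
positive roots; `le_of_wLawAt : WLawAt n B → 10⌊n/3⌋ + (0,2,6)[n%3] ≤ B`; `ten_mul_le_of_wLawAt : WLawAt n B →
10n ≤ 3B + 4` (the W-count grows at least like `(10/3)·n`); `not_wLawAt_three_mul : 3 ≤ n → n ≠ 4 → ¬ WLawAt n (3n)`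
(the refuted budget `3n` fails in EVERY size `≥ 3` except possibly `n = 4`, where blocks give only `12 = 3·4`);
`not_wLawAt_three_mul_sub_one : 2 ≤ n → ¬ WLawAt n (3n − 1)`.  LOCATED, not claimed: the seat's zero forcing finds
`2, 6, 10` at `n = 1, 2, 3` («`4n − 2` so far») and nothing above the block value `12` at `n = 4` (weak instrument).

[folklore] Elementary linear algebra and root bookkeeping over Mathlib; tree inputs `posSemidef_fromBlocks_zero`
(`…StubPsdBlocks`), `WLawTwoWitness.eval_det_pencil₄` / `six_le_card_posRoots_Fw` / `exists_two_325`,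
`WLawThreeWitnessB.exists_three_325`, `SymmetroidDescartes.le_card_posRoots_of_alternating`.  Axioms `propext`,
`Classical.choice`, `Quot.sound`.
-/

-- `Summit.ValiantsHypothesis.ValiantsHypothesis.…` repeats a component by the single-conjunct
-- summit layout, which the `dupNamespace` linter flags; the name is mandated.
set_option linter.dupNamespace false

namespace Summit.ValiantsHypothesis.ValiantsHypothesis.Theorems.LacunarySymmetroidMatrixDescartes

open scoped BigOperators Matrix
open Polynomial

namespace WLawBlockSum

/-! ## Positive-root sets of real polynomials: scaling and products -/

/-- If `q(x) = p(c·x)` for all real `x` with `c > 0`, then `q` and `p` have the same number of distinct positive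
roots (`x ↦ c·x` is a bijection between them). [folklore] -/
theorem card_posRoots_of_eval_comp_mul (p q : ℝ[X]) {c : ℝ} (hc : 0 < c)
    (h : ∀ x, q.eval x = p.eval (c * x)) :
    (q.roots.toFinset.filter (fun t => 0 < t)).card = (p.roots.toFinset.filter (fun t => 0 < t)).card := by
  by_cases hp : p = 0
  · have hq : q = 0 := Polynomial.funext fun x => by rw [h, hp]; simp
    rw [hp, hq]
  · have hq : q ≠ 0 := by
      intro hq
      apply hp
      refine Polynomial.funext fun y => ?_
      have := h (y / c)
      rw [hq, mul_div_cancel₀ y hc.ne'] at this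
      simpa using this.symm
    refine Finset.card_nbij' (fun x => c * x) (fun y => y / c) ?_ ?_ ?_ ?_
    · intro x hx
      simp only [Finset.coe_filter, Set.mem_setOf_eq, Multiset.mem_toFinset, Polynomial.mem_roots hq,
        Polynomial.mem_roots hp, Polynomial.IsRoot.def] at hx ⊢
      exact ⟨by rw [← h]; exact hx.1, mul_pos hc hx.2⟩
    · intro y hy
      simp only [Finset.coe_filter, Set.mem_setOf_eq, Multiset.mem_toFinset, Polynomial.mem_roots hq,
        Polynomial.mem_roots hp, Polynomial.IsRoot.def] at hy ⊢
      exact ⟨by rw [h, mul_div_cancel₀ y hc.ne']; exact hy.1, div_pos hy.2 hc⟩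
    · intro x _
      simp [mul_div_cancel_left₀ x hc.ne']
    · intro y _
      simp [mul_div_cancel₀ y hc.ne']

/-- The distinct positive roots of a product of two NONZERO real polynomials with DISJOINT positive root sets
number exactly the sum. [folklore] -/
theorem card_posRoots_mul_of_disjoint (p q : ℝ[X]) (hp : p ≠ 0) (hq : q ≠ 0)
    (hdis : Disjoint (p.roots.toFinset.filter (fun t => 0 < t)) (q.roots.toFinset.filter (fun t => 0 < t))) :
    ((p * q).roots.toFinset.filter (fun t => 0 < t)).card
      = (p.roots.toFinset.filter (fun t => 0 < t)).card + (q.roots.toFinset.filter (fun t => 0 < t)).card := by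
  rw [Polynomial.roots_mul (mul_ne_zero hp hq), Multiset.toFinset_add, Finset.filter_union,
    Finset.card_union_of_disjoint hdis]

/-- **Generic rescaling separates root sets.**  For nonzero real polynomials `p, q` there is `c > 0` such that
no positive root `x` of `p` has `c·x` a root of `q` (the excluded values `s/r` are finitely many). [folklore] -/
theorem exists_scale_disjoint (p q : ℝ[X]) :
    ∃ c : ℝ, 0 < c ∧ ∀ x, 0 < x → x ∈ p.roots.toFinset → c * x ∉ q.roots.toFinset := by
  classical
  set bad : Finset ℝ := (p.roots.toFinset ×ˢ q.roots.toFinset).image (fun rs => rs.2 / rs.1) with hbad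
  obtain ⟨c, hc, hcbad⟩ := (Set.Ioi_infinite (0 : ℝ)).exists_notMem_finset bad
  refine ⟨c, hc, fun x hx hxp hcx => hcbad ?_⟩
  rw [hbad, Finset.mem_image]
  exact ⟨(x, c * x), Finset.mk_mem_product hxp hcx, by simp [mul_div_cancel_right₀ c hx.ne']⟩

/-! ## W-pencils: evaluation, scaling of the letters, block sums -/

/-- Scaling the letters by `c^{exponent}` rescales the variable: the determinant of the pencil with letters
`c^e J, c^{d₁} P₁, c^{d₂} P₂, c^{d₃} Q` at `x` is the determinant of the original pencil at `c·x`. [folklore] -/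
theorem eval_det_pencil₄_scale {m : ℕ} (e d₁ d₂ d₃ : ℕ) (J P₁ P₂ Q : Matrix (Fin m) (Fin m) ℝ) (c x : ℝ) :
    (Matrix.det (((X : ℝ[X]) ^ e) • (c ^ e • J).map Polynomial.C + ((X : ℝ[X]) ^ d₁) • (c ^ d₁ • P₁).map Polynomial.C
        + ((X : ℝ[X]) ^ d₂) • (c ^ d₂ • P₂).map Polynomial.C + ((X : ℝ[X]) ^ d₃) • (c ^ d₃ • Q).map Polynomial.C)).eval x
      = (Matrix.det (((X : ℝ[X]) ^ e) • J.map Polynomial.C + ((X : ℝ[X]) ^ d₁) • P₁.map Polynomial.C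
        + ((X : ℝ[X]) ^ d₂) • P₂.map Polynomial.C + ((X : ℝ[X]) ^ d₃) • Q.map Polynomial.C)).eval (c * x) := by
  rw [WLawTwoWitness.eval_det_pencil₄, WLawTwoWitness.eval_det_pencil₄]
  congr 1
  simp only [smul_smul, mul_pow]
  ring_nf

/-- Scaled PSD letters are PSD (`c ≥ 0`). [folklore] -/
theorem posSemidef_smul_of_nonneg {m : ℕ} {P : Matrix (Fin m) (Fin m) ℝ} (hP : P.PosSemidef) {a : ℝ}
    (ha : 0 ≤ a) : (a • P).PosSemidef :=
  hP.smul ha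

/-- Scaled symmetric letters are symmetric. [folklore] -/
theorem isSymm_smul {m : ℕ} {J : Matrix (Fin m) (Fin m) ℝ} (hJ : J.IsSymm) (a : ℝ) : (a • J).IsSymm :=
  hJ.smul a

/-- The block-diagonal sum of two letters, reindexed to `Fin (a + b)`. -/
local notation3 (prettyPrint := false) "blk[" A ", " B "]" =>
  Matrix.reindex finSumFinEquiv finSumFinEquiv (Matrix.fromBlocks A 0 0 B)

/-- A block sum of symmetric letters is symmetric. [folklore] -/
theorem isSymm_blk {a b : ℕ} {A : Matrix (Fin a) (Fin a) ℝ} {B : Matrix (Fin b) (Fin b) ℝ}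
    (hA : A.IsSymm) (hB : B.IsSymm) : (blk[A, B]).IsSymm := by
  rw [Matrix.reindex_apply]
  exact (hA.fromBlocks (by simp) hB).submatrix _

/-- A block sum of PSD letters is PSD (tree `posSemidef_fromBlocks_zero`). [folklore] -/
theorem posSemidef_blk {a b : ℕ} {A : Matrix (Fin a) (Fin a) ℝ} {B : Matrix (Fin b) (Fin b) ℝ}
    (hA : A.PosSemidef) (hB : B.PosSemidef) : (blk[A, B]).PosSemidef := by
  rw [Matrix.reindex_apply]
  exact (posSemidef_fromBlocks_zero hA hB).submatrix _

/-- **The block pencil is the block-diagonal matrix of the two pencils** (entrywise). [folklore] -/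
theorem pencil₄_blk {a b : ℕ} (e d₁ d₂ d₃ : ℕ) (J P₁ P₂ Q : Matrix (Fin a) (Fin a) ℝ)
    (J' P₁' P₂' Q' : Matrix (Fin b) (Fin b) ℝ) :
    ((X : ℝ[X]) ^ e) • (blk[J, J']).map Polynomial.C + ((X : ℝ[X]) ^ d₁) • (blk[P₁, P₁']).map Polynomial.C
        + ((X : ℝ[X]) ^ d₂) • (blk[P₂, P₂']).map Polynomial.C + ((X : ℝ[X]) ^ d₃) • (blk[Q, Q']).map Polynomial.C
      = Matrix.reindex finSumFinEquiv finSumFinEquiv (Matrix.fromBlocks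
          (((X : ℝ[X]) ^ e) • J.map Polynomial.C + ((X : ℝ[X]) ^ d₁) • P₁.map Polynomial.C
            + ((X : ℝ[X]) ^ d₂) • P₂.map Polynomial.C + ((X : ℝ[X]) ^ d₃) • Q.map Polynomial.C) 0 0
          (((X : ℝ[X]) ^ e) • J'.map Polynomial.C + ((X : ℝ[X]) ^ d₁) • P₁'.map Polynomial.C
            + ((X : ℝ[X]) ^ d₂) • P₂'.map Polynomial.C + ((X : ℝ[X]) ^ d₃) • Q'.map Polynomial.C)) := by
  ext i j
  obtain ⟨i, rfl⟩ := finSumFinEquiv.surjective i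
  obtain ⟨j, rfl⟩ := finSumFinEquiv.surjective j
  simp only [Matrix.reindex_apply, Matrix.submatrix_apply, Equiv.symm_apply_apply, Matrix.add_apply,
    Matrix.smul_apply, Matrix.map_apply]
  rcases i with i | i <;> rcases j with j | j <;> simp [Matrix.fromBlocks]

/-- Hence the determinant of the block pencil is the product of the two determinants. [folklore] -/
theorem det_pencil₄_blk {a b : ℕ} (e d₁ d₂ d₃ : ℕ) (J P₁ P₂ Q : Matrix (Fin a) (Fin a) ℝ)
    (J' P₁' P₂' Q' : Matrix (Fin b) (Fin b) ℝ) :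
    Matrix.det (((X : ℝ[X]) ^ e) • (blk[J, J']).map Polynomial.C + ((X : ℝ[X]) ^ d₁) • (blk[P₁, P₁']).map Polynomial.C
        + ((X : ℝ[X]) ^ d₂) • (blk[P₂, P₂']).map Polynomial.C + ((X : ℝ[X]) ^ d₃) • (blk[Q, Q']).map Polynomial.C)
      = Matrix.det (((X : ℝ[X]) ^ e) • J.map Polynomial.C + ((X : ℝ[X]) ^ d₁) • P₁.map Polynomial.C
          + ((X : ℝ[X]) ^ d₂) • P₂.map Polynomial.C + ((X : ℝ[X]) ^ d₃) • Q.map Polynomial.C)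
        * Matrix.det (((X : ℝ[X]) ^ e) • J'.map Polynomial.C + ((X : ℝ[X]) ^ d₁) • P₁'.map Polynomial.C
          + ((X : ℝ[X]) ^ d₂) • P₂'.map Polynomial.C + ((X : ℝ[X]) ^ d₃) • Q'.map Polynomial.C) := by
  rw [pencil₄_blk, Matrix.det_reindex_self, Matrix.det_fromBlocks_zero₂₁]

/-! ## The superadditivity theorem -/

/-- A trivial configuration with nonzero determinant and no counted roots is available in every size: letters
`J = P₁ = P₂ = 0`, `Q = 1` (`det = X^{d₃·m}`).  Used to replace a witness whose determinant vanishes identically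
(such a witness certifies only the bound `0`). [folklore] -/
theorem det_pencil₄_trivial {m : ℕ} (e d₁ d₂ d₃ : ℕ) :
    Matrix.det (((X : ℝ[X]) ^ e) • (0 : Matrix (Fin m) (Fin m) ℝ).map Polynomial.C
        + ((X : ℝ[X]) ^ d₁) • (0 : Matrix (Fin m) (Fin m) ℝ).map Polynomial.C
        + ((X : ℝ[X]) ^ d₂) • (0 : Matrix (Fin m) (Fin m) ℝ).map Polynomial.C
        + ((X : ℝ[X]) ^ d₃) • (1 : Matrix (Fin m) (Fin m) ℝ).map Polynomial.C)
      = ((X : ℝ[X]) ^ d₃) ^ m := by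
  simp [Matrix.map_zero _ Polynomial.C_0, Fintype.card_fin]

/-- From a witness of `A ≤ Z₊` extract one whose determinant is a NONZERO polynomial. [folklore] -/
theorem exists_witness_det_ne_zero {m : ℕ} (e d₁ d₂ d₃ : ℕ) {A : ℕ}
    (h : ∃ (J P₁ P₂ Q : Matrix (Fin m) (Fin m) ℝ), J.IsSymm ∧ P₁.PosSemidef ∧ P₂.PosSemidef ∧ Q.PosSemidef ∧
      A ≤ ((Matrix.det (((X : ℝ[X]) ^ e) • J.map Polynomial.C + ((X : ℝ[X]) ^ d₁) • P₁.map Polynomial.C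
        + ((X : ℝ[X]) ^ d₂) • P₂.map Polynomial.C + ((X : ℝ[X]) ^ d₃) • Q.map Polynomial.C)).roots.toFinset.filter
          (fun t => 0 < t)).card) :
    ∃ (J P₁ P₂ Q : Matrix (Fin m) (Fin m) ℝ), J.IsSymm ∧ P₁.PosSemidef ∧ P₂.PosSemidef ∧ Q.PosSemidef ∧
      Matrix.det (((X : ℝ[X]) ^ e) • J.map Polynomial.C + ((X : ℝ[X]) ^ d₁) • P₁.map Polynomial.C
        + ((X : ℝ[X]) ^ d₂) • P₂.map Polynomial.C + ((X : ℝ[X]) ^ d₃) • Q.map Polynomial.C) ≠ 0 ∧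
      A ≤ ((Matrix.det (((X : ℝ[X]) ^ e) • J.map Polynomial.C + ((X : ℝ[X]) ^ d₁) • P₁.map Polynomial.C
        + ((X : ℝ[X]) ^ d₂) • P₂.map Polynomial.C + ((X : ℝ[X]) ^ d₃) • Q.map Polynomial.C)).roots.toFinset.filter
          (fun t => 0 < t)).card := by
  obtain ⟨J, P₁, P₂, Q, hJ, hP₁, hP₂, hQ, hA⟩ := h
  by_cases hdet : Matrix.det (((X : ℝ[X]) ^ e) • J.map Polynomial.C + ((X : ℝ[X]) ^ d₁) • P₁.map Polynomial.C
        + ((X : ℝ[X]) ^ d₂) • P₂.map Polynomial.C + ((X : ℝ[X]) ^ d₃) • Q.map Polynomial.C) = 0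
  · -- the witness certifies only `A = 0`; use the trivial configuration instead
    rw [hdet, Polynomial.roots_zero, Multiset.toFinset_zero, Finset.filter_empty, Finset.card_empty,
      Nat.le_zero] at hA
    subst hA
    refine ⟨0, 0, 0, 1, Matrix.isSymm_zero, Matrix.PosSemidef.zero, Matrix.PosSemidef.zero,
      Matrix.PosSemidef.one, ?_, Nat.zero_le _⟩
    rw [det_pencil₄_trivial]
    exact pow_ne_zero _ (pow_ne_zero _ Polynomial.X_ne_zero)
  · exact ⟨J, P₁, P₂, Q, hJ, hP₁, hP₂, hQ, hdet, hA⟩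

/-- **SUPERADDITIVITY OF ATTAINABLE W-COUNTS ON A COMMON SUPPORT.**  If some `a × a` W-configuration on the exponents
`(e; d₁, d₂; d₃)` has at least `A` distinct positive determinant roots and some `b × b` one (same exponents) has at
least `B`, then some `(a+b) × (a+b)` W-configuration on the same exponents has at least `A + B`: the block-diagonal
sum of the first with a generic rescaling `x ↦ c·x` of the second (letters scaled by `c^{exponent}`, which keeps
symmetry and positive semidefiniteness), `c > 0` chosen outside the finitely many ratios of roots so that the two
positive root sets are disjoint. [folklore] -/
theorem superadditive (e d₁ d₂ d₃ : ℕ) {a b A B : ℕ}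
    (ha : ∃ (J P₁ P₂ Q : Matrix (Fin a) (Fin a) ℝ), J.IsSymm ∧ P₁.PosSemidef ∧ P₂.PosSemidef ∧ Q.PosSemidef ∧
      A ≤ ((Matrix.det (((X : ℝ[X]) ^ e) • J.map Polynomial.C + ((X : ℝ[X]) ^ d₁) • P₁.map Polynomial.C
        + ((X : ℝ[X]) ^ d₂) • P₂.map Polynomial.C + ((X : ℝ[X]) ^ d₃) • Q.map Polynomial.C)).roots.toFinset.filter
          (fun t => 0 < t)).card)
    (hb : ∃ (J P₁ P₂ Q : Matrix (Fin b) (Fin b) ℝ), J.IsSymm ∧ P₁.PosSemidef ∧ P₂.PosSemidef ∧ Q.PosSemidef ∧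
      B ≤ ((Matrix.det (((X : ℝ[X]) ^ e) • J.map Polynomial.C + ((X : ℝ[X]) ^ d₁) • P₁.map Polynomial.C
        + ((X : ℝ[X]) ^ d₂) • P₂.map Polynomial.C + ((X : ℝ[X]) ^ d₃) • Q.map Polynomial.C)).roots.toFinset.filter
          (fun t => 0 < t)).card) :
    ∃ (J P₁ P₂ Q : Matrix (Fin (a + b)) (Fin (a + b)) ℝ), J.IsSymm ∧ P₁.PosSemidef ∧ P₂.PosSemidef ∧ Q.PosSemidef ∧
      A + B ≤ ((Matrix.det (((X : ℝ[X]) ^ e) • J.map Polynomial.C + ((X : ℝ[X]) ^ d₁) • P₁.map Polynomial.C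
        + ((X : ℝ[X]) ^ d₂) • P₂.map Polynomial.C + ((X : ℝ[X]) ^ d₃) • Q.map Polynomial.C)).roots.toFinset.filter
          (fun t => 0 < t)).card := by
  obtain ⟨J, P₁, P₂, Q, hJ, hP₁, hP₂, hQ, hpne, hA⟩ := exists_witness_det_ne_zero e d₁ d₂ d₃ ha
  obtain ⟨J', P₁', P₂', Q', hJ', hP₁', hP₂', hQ', hqne, hB⟩ := exists_witness_det_ne_zero e d₁ d₂ d₃ hb
  -- the two determinant polynomials
  set p := Matrix.det (((X : ℝ[X]) ^ e) • J.map Polynomial.C + ((X : ℝ[X]) ^ d₁) • P₁.map Polynomial.C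
        + ((X : ℝ[X]) ^ d₂) • P₂.map Polynomial.C + ((X : ℝ[X]) ^ d₃) • Q.map Polynomial.C) with hp
  set q := Matrix.det (((X : ℝ[X]) ^ e) • J'.map Polynomial.C + ((X : ℝ[X]) ^ d₁) • P₁'.map Polynomial.C
        + ((X : ℝ[X]) ^ d₂) • P₂'.map Polynomial.C + ((X : ℝ[X]) ^ d₃) • Q'.map Polynomial.C) with hq
  -- a generic positive scale
  obtain ⟨c, hc, hsep⟩ := exists_scale_disjoint p q
  -- the rescaled second configuration and its determinant
  set qc := Matrix.det (((X : ℝ[X]) ^ e) • (c ^ e • J').map Polynomial.C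
        + ((X : ℝ[X]) ^ d₁) • (c ^ d₁ • P₁').map Polynomial.C
        + ((X : ℝ[X]) ^ d₂) • (c ^ d₂ • P₂').map Polynomial.C + ((X : ℝ[X]) ^ d₃) • (c ^ d₃ • Q').map Polynomial.C)
    with hqc
  have hqc_eval : ∀ x, qc.eval x = q.eval (c * x) := fun x => eval_det_pencil₄_scale e d₁ d₂ d₃ J' P₁' P₂' Q' c x
  have hqc_card := card_posRoots_of_eval_comp_mul q qc hc hqc_eval
  have hqcne : qc ≠ 0 := by
    intro h0
    apply hqne
    refine Polynomial.funext fun y => ?_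
    have := hqc_eval (y / c)
    rw [h0, mul_div_cancel₀ y hc.ne'] at this
    simpa using this.symm
  -- disjointness of the positive root sets of `p` and `qc`
  have hdis : Disjoint (p.roots.toFinset.filter (fun t => 0 < t)) (qc.roots.toFinset.filter (fun t => 0 < t)) := by
    rw [Finset.disjoint_left]
    intro x hxp hxq
    rw [Finset.mem_filter] at hxp hxq
    refine hsep x hxp.2 hxp.1 ?_
    rw [Multiset.mem_toFinset, Polynomial.mem_roots hqne, Polynomial.IsRoot.def, ← hqc_eval]
    exact (Polynomial.mem_roots hqcne).1 (Multiset.mem_toFinset.1 hxq.1)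
  -- the block configuration
  refine ⟨blk[J, c ^ e • J'], blk[P₁, c ^ d₁ • P₁'], blk[P₂, c ^ d₂ • P₂'], blk[Q, c ^ d₃ • Q'],
    isSymm_blk hJ (hJ'.smul _), posSemidef_blk hP₁ (hP₁'.smul (pow_nonneg hc.le _)),
    posSemidef_blk hP₂ (hP₂'.smul (pow_nonneg hc.le _)), posSemidef_blk hQ (hQ'.smul (pow_nonneg hc.le _)), ?_⟩
  rw [det_pencil₄_blk, ← hp, ← hqc, card_posRoots_mul_of_disjoint p qc hpne hqcne hdis, hqc_card]
  exact Nat.add_le_add hA hB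


/-! ## Assembly on the common support `(3; 2, 0; 5)`: W-configurations of every size -/

/-- «some `n × n` W-configuration on the exponents `(3; 2, 0; 5)` has at least `A` distinct positive roots» -/
local notation3 (prettyPrint := false) "WAtt[" n ", " A "]" =>
  ∃ (J P₁ P₂ Q : Matrix (Fin n) (Fin n) ℝ), J.IsSymm ∧ P₁.PosSemidef ∧ P₂.PosSemidef ∧ Q.PosSemidef ∧
    A ≤ ((Matrix.det (((X : ℝ[X]) ^ 3) • J.map Polynomial.C + ((X : ℝ[X]) ^ 2) • P₁.map Polynomial.C
      + ((X : ℝ[X]) ^ 0) • P₂.map Polynomial.C + ((X : ℝ[X]) ^ 5) • Q.map Polynomial.C)).roots.toFinset.filter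
        (fun t => 0 < t)).card

/-- Transport of attainability along an equality of sizes. [bookkeeping] -/
theorem watt_cast {m n A : ℕ} (h : m = n) (hm : WAtt[m, A]) : WAtt[n, A] := by
  subst h
  exact hm

/-- Attainability is monotone in the count. [bookkeeping] -/
theorem watt_mono {n A A' : ℕ} (h : A' ≤ A) (hn : WAtt[n, A]) : WAtt[n, A'] := by
  obtain ⟨J, P₁, P₂, Q, hJ, hP₁, hP₂, hQ, hA⟩ := hn
  exact ⟨J, P₁, P₂, Q, hJ, hP₁, hP₂, hQ, h.trans hA⟩

/-- Size `0`: the empty configuration attains `0`. [bookkeeping] -/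
theorem watt_zero : WAtt[0, 0] :=
  ⟨0, 0, 0, 0, Matrix.isSymm_zero, Matrix.PosSemidef.zero, Matrix.PosSemidef.zero, Matrix.PosSemidef.zero,
    Nat.zero_le _⟩

/-- Size `1`: the scalar W-function `x⁵ − 4x³ + x² + 1` (`J = −4`, `P₁ = P₂ = Q = 1`) has two positive roots
(signs `+, −, +` at `1/2, 1, 2`). [folklore] -/
theorem watt_one : WAtt[1, 2] := by
  refine ⟨(-4 : ℝ) • 1, 1, 1, 1, Matrix.isSymm_one.smul _, Matrix.PosSemidef.one, Matrix.PosSemidef.one,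
    Matrix.PosSemidef.one, ?_⟩
  have hev : ∀ t : ℝ, (Matrix.det (((X : ℝ[X]) ^ 3) • ((-4 : ℝ) • (1 : Matrix (Fin 1) (Fin 1) ℝ)).map Polynomial.C
      + ((X : ℝ[X]) ^ 2) • (1 : Matrix (Fin 1) (Fin 1) ℝ).map Polynomial.C
      + ((X : ℝ[X]) ^ 0) • (1 : Matrix (Fin 1) (Fin 1) ℝ).map Polynomial.C
      + ((X : ℝ[X]) ^ 5) • (1 : Matrix (Fin 1) (Fin 1) ℝ).map Polynomial.C)).eval t
      = t ^ 5 - 4 * t ^ 3 + t ^ 2 + 1 := by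
    intro t
    rw [WLawTwoWitness.eval_det_pencil₄, Matrix.det_fin_one]
    simp [Matrix.add_apply, Matrix.smul_apply]
    ring
  refine Summit.ValiantsHypothesis.ValiantsHypothesis.Theorems.SymmetroidDescartes.le_card_posRoots_of_alternating
    _ 2 ![1/2, 1, 2] ?_ ?_ ?_
  · refine Fin.strictMono_iff_lt_succ.2 fun j => ?_
    fin_cases j
    · show (1 : ℝ) / 2 < 1; norm_num
    · show (1 : ℝ) < 2; norm_num
  · intro j; fin_cases j <;> simp
  · intro j; fin_cases j <;> simp only [hev] <;> simp <;> norm_num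

/-- Size `2`: the tree's six-root witness `Fw`. -/
theorem watt_two : WAtt[2, 6] := WLawTwoWitness.exists_two_325

/-- Size `3`: the ten-root witness `F₃'` of `…WLawThreeWitnessB`. -/
theorem watt_three : WAtt[3, 10] := WLawThreeWitnessB.exists_three_325

/-- **Every size**: for `n = 3j + r` (`r = n % 3`), some `n × n` W-configuration on the support `(3; 2, 0; 5)` has at
least `10j + (0, 2, 6)[r]` distinct positive roots (block sums of `j` copies of the size-3 witness and one size-`r`
piece; the count is written `10·(n/3) + 2·(n%3) + 2·((n%3)/2)`). [folklore] -/
theorem watt_all (n : ℕ) : WAtt[n, 10 * (n / 3) + 2 * (n % 3) + 2 * (n % 3 / 2)] := by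
  induction n using Nat.strong_induction_on with
  | _ n ih =>
    rcases lt_or_ge n 3 with hn | hn
    · interval_cases n
      · exact watt_zero
      · exact watt_one
      · exact watt_two
    · have h := superadditive 3 2 0 5 (ih (n - 3) (by omega)) watt_three
      have hsize : n - 3 + 3 = n := by omega
      refine watt_mono ?_ (watt_cast hsize h)
      omega

end WLawBlockSum

open WLawBlockSum in
/-- **LOWER BOUND FOR THE W-LAW ROWS, ALL SIZES**: if `WLawAt n B` holds then `B ≥ 10⌊n/3⌋ + (0, 2, 6)[n mod 3]`;
in particular `3B ≥ 10n − 4`, i.e. the W-count grows at least like `(10/3)·n`. [folklore] -/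
theorem le_of_wLawAt {n B : ℕ} (h : WLawAt n B) : 10 * (n / 3) + 2 * (n % 3) + 2 * (n % 3 / 2) ≤ B := by
  obtain ⟨J, P₁, P₂, Q, hJ, hP₁, hP₂, hQ, hA⟩ := watt_all n
  exact hA.trans (h 3 2 0 5 J P₁ P₂ Q hJ hP₁ hP₂ hQ (by norm_num) (by norm_num) (by norm_num))

/-- Linear form: `WLawAt n B → 10·n ≤ 3·B + 4`. [bookkeeping] -/
theorem ten_mul_le_of_wLawAt {n B : ℕ} (h : WLawAt n B) : 10 * n ≤ 3 * B + 4 := by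
  have := le_of_wLawAt h
  omega

/-- **The refuted budget `3n` fails in EVERY size `n ≥ 3` except possibly `n = 4`** (where block sums give only
`12 = 3·4`; a direct `4 × 4` witness with `13` roots is not in hand). [folklore] -/
theorem not_wLawAt_three_mul {n : ℕ} (h3 : 3 ≤ n) (h4 : n ≠ 4) : ¬ WLawAt n (3 * n) := by
  intro h
  have := le_of_wLawAt h
  omega

/-- For every `n ≥ 2` the budget `3n − 1` fails (`w(n) ≥ 3n`; at `n = 4` this is `12`). [folklore] -/
theorem not_wLawAt_three_mul_sub_one {n : ℕ} (h2 : 2 ≤ n) : ¬ WLawAt n (3 * n - 1) := by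
  intro h
  have := le_of_wLawAt h
  omega

/-- Attainability statement in census words: for every `n`, some `n × n` W-configuration (on the fixed support
`(3; 2, 0; 5)`) has at least `10⌊n/3⌋ + (0,2,6)[n mod 3]` distinct positive determinant roots. [folklore] -/
theorem exists_wConfig_many_roots (n : ℕ) :
    ∃ (J P₁ P₂ Q : Matrix (Fin n) (Fin n) ℝ), J.IsSymm ∧ P₁.PosSemidef ∧ P₂.PosSemidef ∧ Q.PosSemidef ∧
      10 * (n / 3) + 2 * (n % 3) + 2 * (n % 3 / 2)
        ≤ ((Matrix.det (((X : ℝ[X]) ^ 3) • J.map Polynomial.C + ((X : ℝ[X]) ^ 2) • P₁.map Polynomial.C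
          + ((X : ℝ[X]) ^ 0) • P₂.map Polynomial.C + ((X : ℝ[X]) ^ 5) • Q.map Polynomial.C)).roots.toFinset.filter
            (fun t => 0 < t)).card :=
  WLawBlockSum.watt_all n

end Summit.ValiantsHypothesis.ValiantsHypothesis.Theorems.LacunarySymmetroidMatrixDescartes
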